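import Summits.SmoothPoincare4.SmoothPoincare4.Theorems.CongruenceShadowsShadowApproximationStubFramingZero
import Literature.GroupTheory.CombinatorialGroupTheory.NielsenMoves

/-!
# Stub `stub_genusThreeNielsen` of line `free-shadow-tsystem` for crux `CongruenceShadows.ShadowApproximation`
(item stmt-SmoothPoincare4-14595, route route-SmoothPoincare4-CongruenceShadows) — the Nielsen
level at genus `3` is vacuous

Proves the registered stub **`stub_genusThreeNielsen`** verbatim.  Setting (`m = 0`): `K` a `(3;1)`
group trisection of `{1}` with `K₀ = N₀`, `K₁ = N₁` (`N = s4Kernels`); `F = S₃ ⧸ N₀ = π₁(H₀) ≅ F₃`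
on `x₀, x₁, x₂ = b̄₀, b̄₁, ā₂` (the landed `epsH 0`); `Ū = N₁ mod N₀ = ⟪x₁, x₂⟫`,
`V̄_N = N₂ mod N₀ = ⟪x₀, x₂⟫`, `V̄_K = K₂ mod N₀`.  CLAIM: `θ(Ū) = Ū`, `θ(V̄_N) = V̄_K` for some
`θ ∈ Aut F`.
§1 (free group).  For a character `χ : F₃ → ℤ` with `(χ x₁, χ x₂)` coprime some `θ ∈ Aut F₃` has
`θ(Ū) = Ū` and `ker (χ ∘ θ) = ⟪x₀, x₂⟫` (`exists_aut_of_isCoprime`): Euclid's algorithm on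
`(χ x₁, χ x₂)` by the power transvections `x₁ ↦ x₁x₂ᶜ`, `x₂ ↦ x₂x₁ᶜ` (Nielsen automorphisms
`transvect`, from `replaceAut` of `NielsenMoves.lean`; they preserve `Ū`) reaches the values
`(·, ±1, 0)` (`euclid`); a last transvection `x₀ ↦ x₀x₁ᶜ` makes them `(0, ±1, 0)`; and a character
with these values has kernel exactly `⟪x₀, x₂⟫` (`ker_eq_V02`: its factorisation through the cyclic
group `F₃ ⧸ ⟪x₀, x₂⟫ = ⟨x̄₁⟩` is split by `n ↦ x̄₁^{±n}`).
§2 (transfer).  Along `f = ε₀ ∘ (mod N₀) : S₃ ↠ F₃` (`a₀, a₁, b₂ ↦ 1`; `b₀, b₁, a₂ ↦ x₀, x₁, x₂`):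
`f(N₁) = Ū`, `f(N₂) = ⟪x₀, x₂⟫`; the pair quotient `S₃ ⧸ ⟪K₀ ∪ K₂⟫ ≅ F₁ ≅ ℤ` (`free_pairQuotient 0 2`)
gives `χ_S : S₃ ↠ ℤ` with kernel `⟪K₀ ∪ K₂⟫ ⊇ N₀`, descending to `χ : F₃ ↠ ℤ` with `ker χ = f(K₂)`;
`triple` (`⟪K₀ ∪ K₁ ∪ K₂⟫ = S₃`) gives `χ(f(N₁)) = ℤ`, i.e. `(χ x₁, χ x₂)` coprime.  With `θ'` from
§1, `θ'(⟪x₀, x₂⟫) = θ'(ker (χ ∘ θ')) = ker χ = f(K₂)`, and `θ = ε₀⁻¹ θ' ε₀` is the required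
automorphism of `S₃ ⧸ N₀`.  The Waldhausen-pairs hypothesis of the stub is not used. [folklore]
-/

-- the prescribed namespace `Summit.<P>.<Sub>.…` duplicates `SmoothPoincare4` (P = Sub)
set_option linter.dupNamespace false
noncomputable section
open Literature.Topology.FourManifolds Literature.GroupTheory.CombinatorialGroupTheory Multiplicative
open Summit.SmoothPoincare4.SmoothPoincare4.Theorems.ShadowApproximation.EpiClassLivingston

namespace Summit.SmoothPoincare4.SmoothPoincare4.Theorems.ShadowApproximation.FreeShadowTsystem

/-! ## §1 Nielsen moves on `F₃` against a character `χ : F₃ → ℤ` -/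

/-- The free group of rank `3` (`= π₁(H₀)` in the basis `x₀, x₁, x₂ = b̄₀, b̄₁, ā₂`). -/
abbrev F₃ : Type := FreeGroup (Fin 3)

/-- `Ū = ⟪x₁, x₂⟫`, the image of `N₁` in `F₃`. -/
def U12 : Subgroup F₃ := Subgroup.normalClosure {FreeGroup.of 1, FreeGroup.of 2}

/-- `V̄_N = ⟪x₀, x₂⟫`, the image of `N₂` in `F₃`. -/
def V02 : Subgroup F₃ := Subgroup.normalClosure {FreeGroup.of 0, FreeGroup.of 2}

/-- `Ū` is normal. -/
instance U12_normal : U12.Normal := Subgroup.normalClosure_normal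

/-- `V̄_N` is normal. -/
instance V02_normal : V02.Normal := Subgroup.normalClosure_normal

/-- The value of a character `χ : F₃ → ℤ` on the basis element `xᵢ`. -/
def val (χ : F₃ →* Multiplicative ℤ) (i : Fin 3) : ℤ := toAdd (χ (FreeGroup.of i))

/-- `θ` is *good* for `χ`: `θ(Ū) = Ū` and `χ ∘ θ` has the values `(·, ±1, 0)` on the basis. -/
local notation "Good⟪" χ ", " θ "⟫" => U12.map (MulEquiv.toMonoidHom θ) = U12 ∧
  IsUnit (val (MonoidHom.comp χ (MulEquiv.toMonoidHom θ)) 1) ∧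
    val (MonoidHom.comp χ (MulEquiv.toMonoidHom θ)) 2 = 0

/-- The power transvection `x_k ↦ x_k x_lᶜ` (other basis elements fixed), a Nielsen automorphism
of `F₃` (inverse `x_k ↦ x_k x_l⁻ᶜ`). -/
def transvect (k l : Fin 3) (hkl : k ≠ l) (c : ℤ) : F₃ ≃* F₃ :=
  replaceAut k (FreeGroup.of k * FreeGroup.of l ^ c) (FreeGroup.of k * FreeGroup.of l ^ (-c))
    (by rw [map_mul, map_zpow, replaceHom_of_self, replaceHom_of_ne hkl.symm, mul_assoc, zpow_neg,
      inv_mul_cancel, mul_one])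
    (by rw [map_mul, map_zpow, replaceHom_of_self, replaceHom_of_ne hkl.symm, mul_assoc, zpow_neg,
      mul_inv_cancel, mul_one])

/-- `transvect` on `x_k`. [folklore] -/
@[simp] theorem transvect_of_self (k l : Fin 3) (hkl : k ≠ l) (c : ℤ) :
    transvect k l hkl c (FreeGroup.of k) = FreeGroup.of k * FreeGroup.of l ^ c :=
  replaceAut_of_self _ _ _ _ _

/-- `transvect` fixes the other basis elements. [folklore] -/
theorem transvect_of_ne {k l j : Fin 3} (hkl : k ≠ l) (c : ℤ) (hj : j ≠ k) :
    transvect k l hkl c (FreeGroup.of j) = FreeGroup.of j :=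
  replaceAut_of_ne hj _ _ _ _

/-- Effect on characters: `(χ ∘ T)(x_k) = χ x_k + c χ x_l`. [folklore] -/
theorem val_transvect_self (χ : F₃ →* Multiplicative ℤ) (k l : Fin 3) (hkl : k ≠ l) (c : ℤ) :
    val (χ.comp (transvect k l hkl c).toMonoidHom) k = val χ k + c * val χ l := by
  simp [val, toAdd_zpow]

/-- Effect on characters: the other values are unchanged. [folklore] -/
theorem val_transvect_ne (χ : F₃ →* Multiplicative ℤ) {k l j : Fin 3} (hkl : k ≠ l) (c : ℤ)
    (hj : j ≠ k) : val (χ.comp (transvect k l hkl c).toMonoidHom) j = val χ j := by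
  simp [val, transvect_of_ne hkl c hj]

/-- `transvect (-c)` undoes `transvect c`. [folklore] -/
theorem transvect_neg_apply (k l : Fin 3) (hkl : k ≠ l) (c : ℤ) (y : F₃) :
    transvect k l hkl (-c) (transvect k l hkl c y) = y := by
  have h : (transvect k l hkl (-c)).toMonoidHom.comp (transvect k l hkl c).toMonoidHom = .id _ := by
    refine FreeGroup.ext_hom _ _ fun j => ?_
    rcases eq_or_ne j k with rfl | hj
    · simp [map_zpow, transvect_of_ne hkl _ hkl.symm]
    · simp [transvect_of_ne hkl _ hj]
  exact DFunLike.congr_fun h y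

/-- `x₁, x₂ ∈ Ū`. [folklore] -/
theorem of_mem_U12 {j : Fin 3} (hj : j ≠ 0) : (FreeGroup.of j : F₃) ∈ U12 := by
  refine Subgroup.subset_normalClosure ?_
  fin_cases j <;> simp at hj ⊢

/-- A transvection `x_k ↦ x_k x_lᶜ` with `l ≠ 0` maps `x₁, x₂` into `Ū`. [folklore] -/
theorem transvect_mem_U12 (k l : Fin 3) (hkl : k ≠ l) (hl : l ≠ 0) (c : ℤ) {j : Fin 3} (hj : j ≠ 0) :
    transvect k l hkl c (FreeGroup.of j) ∈ U12 := by
  rcases eq_or_ne j k with rfl | hjk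
  · rw [transvect_of_self]; exact mul_mem (of_mem_U12 hj) (zpow_mem (of_mem_U12 hl) c)
  · rw [transvect_of_ne hkl c hjk]; exact of_mem_U12 hj

/-- **The transvections `x_k ↦ x_k x_lᶜ`, `l ≠ 0`, preserve `Ū`** (`T^{±1} xᵢ ∈ Ū`, `i = 1, 2`).
[folklore] -/
theorem transvect_mapU (k l : Fin 3) (hkl : k ≠ l) (hl : l ≠ 0) (c : ℤ) :
    U12.map (transvect k l hkl c).toMonoidHom = U12 := by
  have key : ∀ c : ℤ, U12 ≤ U12.comap (transvect k l hkl c).toMonoidHom := fun c =>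
    Subgroup.normalClosure_le_normal (Set.insert_subset_iff.2 ⟨transvect_mem_U12 k l hkl hl c
      (by decide), Set.singleton_subset_iff.2 (transvect_mem_U12 k l hkl hl c (by decide))⟩)
  refine le_antisymm (Subgroup.map_le_iff_le_comap.2 (key c)) fun z hz => ?_
  exact ⟨_, key (-c) hz, by simpa using transvect_neg_apply k l hkl (-c) z⟩

/-- Goodness is transported by a `Ū`-preserving `T`: good for `χ ∘ T` ⟹ `θT` good for `χ`.
[folklore] -/
theorem good_trans {χ : F₃ →* Multiplicative ℤ} {T θ : F₃ ≃* F₃} (hTU : U12.map T.toMonoidHom = U12)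
    (h : Good⟪χ.comp T.toMonoidHom, θ⟫) : Good⟪χ, θ.trans T⟫ := by
  refine ⟨?_, h.2.1, h.2.2⟩
  rw [show (θ.trans T).toMonoidHom = T.toMonoidHom.comp θ.toMonoidHom from rfl, ← Subgroup.map_map,
    h.1, hTU]

/-- Values `(·, a, 0)` with `(a, 0)` coprime: the identity is good. [folklore] -/
theorem good_refl {χ : F₃ →* Multiplicative ℤ} (hc : IsCoprime (val χ 1) (val χ 2))
    (h2 : val χ 2 = 0) : Good⟪χ, MulEquiv.refl F₃⟫ := by
  refine ⟨by ext z; simp, ?_, h2⟩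
  rw [h2] at hc
  exact isCoprime_zero_right.1 hc

/-- Values `(·, 0, b)` (so `b = ±1`): `x₁ ↦ x₁x₂` followed by `x₂ ↦ x₂x₁⁻¹` is good. [folklore] -/
theorem good_of_fst {χ : F₃ →* Multiplicative ℤ} (hc : IsCoprime (val χ 1) (val χ 2))
    (h1 : val χ 1 = 0) : ∃ θ : F₃ ≃* F₃, Good⟪χ, θ⟫ := by
  rw [h1] at hc
  let T₂ := transvect 1 2 (by decide) 1
  let T₃ := transvect 2 1 (by decide) (-1)
  have ha' : val (χ.comp T₂.toMonoidHom) 1 = val χ 2 := by rw [val_transvect_self, h1]; ring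
  have ha'' : val ((χ.comp T₂.toMonoidHom).comp T₃.toMonoidHom) 1 = val χ 2 := by
    rw [val_transvect_ne _ _ (-1) (by decide), ha']
  have hb'' : val ((χ.comp T₂.toMonoidHom).comp T₃.toMonoidHom) 2 = 0 := by
    rw [val_transvect_self, ha', val_transvect_ne χ _ 1 (by decide)]; ring
  refine ⟨((MulEquiv.refl _).trans T₃).trans T₂, good_trans (transvect_mapU 1 2 _ (by decide) 1)
    (good_trans (transvect_mapU 2 1 _ (by decide) (-1)) (good_refl ?_ hb''))⟩
  rw [ha'', hb'']
  exact isCoprime_zero_right.2 (isCoprime_zero_left.1 hc)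

/-- **Euclid's algorithm by Nielsen moves on `(x₁, x₂)`**: if `(χ x₁, χ x₂)` are coprime, a good `θ`
exists (induction on `min |χ x₁| |χ x₂|`: reduce the larger value modulo the smaller). [folklore] -/
theorem euclid : ∀ (n : ℕ) (χ : F₃ →* Multiplicative ℤ), min (val χ 1).natAbs (val χ 2).natAbs ≤ n →
    IsCoprime (val χ 1) (val χ 2) → ∃ θ : F₃ ≃* F₃, Good⟪χ, θ⟫
  | 0, χ, hn, hc => by
      rcases Nat.min_eq_zero_iff.1 (Nat.le_zero.1 hn) with h | h
      · exact good_of_fst hc (Int.natAbs_eq_zero.1 h)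
      · exact ⟨_, good_refl hc (Int.natAbs_eq_zero.1 h)⟩
  | n + 1, χ, hn, hc => by
      by_cases h1 : val χ 1 = 0
      · exact good_of_fst hc h1
      by_cases h2 : val χ 2 = 0
      · exact ⟨_, good_refl hc h2⟩
      set a := val χ 1 with ha
      set b := val χ 2 with hb
      rcases le_total b.natAbs a.natAbs with hle | hle
      · -- reduce `χ x₁` modulo `χ x₂` by `x₁ ↦ x₁ x₂ ^ (-(a / b))`
        let T := transvect 1 2 (by decide) (-(a / b))
        have hdiv := Int.emod_add_mul_ediv a b
        have ha' : val (χ.comp T.toMonoidHom) 1 = a % b := by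
          rw [val_transvect_self]; linear_combination -hdiv
        have hb' : val (χ.comp T.toMonoidHom) 2 = b := val_transvect_ne χ _ _ (by decide)
        obtain ⟨θ, hθ⟩ := euclid n (χ.comp T.toMonoidHom)
          (by rw [ha', hb']; have := Int.emod_nonneg a h2; have := Int.emod_lt a h2; omega)
          (by rw [ha', hb', show a % b = a + b * (-(a / b)) by linear_combination hdiv]
              exact hc.add_mul_left_left _)
        exact ⟨θ.trans T, good_trans (transvect_mapU 1 2 _ (by decide) _) hθ⟩
      · -- reduce `χ x₂` modulo `χ x₁` by `x₂ ↦ x₂ x₁ ^ (-(b / a))`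
        let T := transvect 2 1 (by decide) (-(b / a))
        have hdiv := Int.emod_add_mul_ediv b a
        have hb' : val (χ.comp T.toMonoidHom) 2 = b % a := by
          rw [val_transvect_self]; linear_combination -hdiv
        have ha' : val (χ.comp T.toMonoidHom) 1 = a := val_transvect_ne χ _ _ (by decide)
        obtain ⟨θ, hθ⟩ := euclid n (χ.comp T.toMonoidHom)
          (by rw [ha', hb']; have := Int.emod_nonneg b h1; have := Int.emod_lt b h1; omega)
          (by rw [ha', hb', show b % a = b + a * (-(b / a)) by linear_combination hdiv]
              exact hc.add_mul_left_right _)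
        exact ⟨θ.trans T, good_trans (transvect_mapU 2 1 _ (by decide) _) hθ⟩

/-- **`ker (0, ±1, 0) = ⟪x₀, x₂⟫`**: a character killing `x₀, x₂` and primitive on `x₁` has kernel
`V̄_N` (its factorisation through the cyclic group `F₃ ⧸ ⟪x₀, x₂⟫` is split by `n ↦ x̄₁^{±n}`). [folklore] -/
theorem ker_eq_V02 (ψ : F₃ →* Multiplicative ℤ) (h0 : ψ (FreeGroup.of 0) = 1)
    (h2 : ψ (FreeGroup.of 2) = 1) (hu : IsUnit (toAdd (ψ (FreeGroup.of 1)))) : ψ.ker = V02 := by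
  have hle : V02 ≤ ψ.ker :=
    Subgroup.normalClosure_le_normal (by rintro y (rfl | rfl); exacts [h0, h2])
  refine le_antisymm (fun y hy => ?_) hle
  set u := toAdd (ψ (FreeGroup.of 1)) with hu'
  let σ : Multiplicative ℤ →* F₃ ⧸ V02 := zpowersHom _ ((QuotientGroup.mk (FreeGroup.of 1)) ^ u)
  have hmk : ∀ j : Fin 3, j ≠ 1 → (QuotientGroup.mk (FreeGroup.of j) : F₃ ⧸ V02) = 1 := by
    intro j hj
    refine (QuotientGroup.eq_one_iff _).2 (Subgroup.subset_normalClosure ?_)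
    fin_cases j <;> simp at hj ⊢
  have hσ : σ.comp (QuotientGroup.lift V02 ψ hle) = MonoidHom.id _ := by
    refine QuotientGroup.monoidHom_ext _ (FreeGroup.ext_hom _ _ fun i => ?_)
    fin_cases i
    · simp [hmk 0 (by decide)]
    · rcases Int.isUnit_iff.1 hu with h | h
      · simp [σ, ← hu', h]
      · simp [σ, ← hu', h]
    · simp [hmk 2 (by decide)]
  have : (QuotientGroup.mk y : F₃ ⧸ V02) = 1 := by
    rw [← MonoidHom.id_apply (F₃ ⧸ V02) (QuotientGroup.mk y), ← hσ, MonoidHom.comp_apply,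
      QuotientGroup.lift_mk, (MonoidHom.mem_ker).1 hy, map_one]
  exact (QuotientGroup.eq_one_iff y).1 this

/-- **The Nielsen level at genus 3, free-group form.** For a character `χ : F₃ → ℤ` with coprime
values on `x₁, x₂` some automorphism `θ` of `F₃` has `θ(Ū) = Ū` and `ker (χ ∘ θ) = ⟪x₀, x₂⟫` (after
`euclid`, the transvection `x₀ ↦ x₀ x₁ᶜ`, `c = -χ(x₀)·(±1)`, kills the value on `x₀`). [folklore] -/
theorem exists_aut_of_isCoprime (χ : F₃ →* Multiplicative ℤ) (hc : IsCoprime (val χ 1) (val χ 2)) :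
    ∃ θ : F₃ ≃* F₃, U12.map θ.toMonoidHom = U12 ∧ (χ.comp θ.toMonoidHom).ker = V02 := by
  obtain ⟨θ₁, hU, h1, h2⟩ := euclid _ χ le_rfl hc
  set χ₁ := χ.comp θ₁.toMonoidHom with hχ₁
  set u := val χ₁ 1 with hu
  set c₀ := val χ₁ 0 with hc₀
  let T := transvect 0 1 (by decide) (-(c₀ * u))
  have huu : u * u = 1 := by rcases Int.isUnit_iff.1 h1 with h' | h' <;> rw [h'] <;> norm_num
  refine ⟨T.trans θ₁, ?_, ?_⟩
  · rw [show (T.trans θ₁).toMonoidHom = θ₁.toMonoidHom.comp T.toMonoidHom from rfl,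
      ← Subgroup.map_map, transvect_mapU 0 1 _ (by decide), hU]
  · rw [show χ.comp (T.trans θ₁).toMonoidHom = χ₁.comp T.toMonoidHom from rfl]
    apply ker_eq_V02
    · rw [← toAdd_eq_zero]
      change val (χ₁.comp T.toMonoidHom) 0 = 0
      rw [val_transvect_self, ← hc₀, ← hu]
      linear_combination (-c₀) * huu
    · rw [← toAdd_eq_zero]
      change val (χ₁.comp T.toMonoidHom) 2 = 0
      rw [val_transvect_ne χ₁ _ _ (by decide)]
      exact h2
    · change IsUnit (val (χ₁.comp T.toMonoidHom) 1)
      rw [val_transvect_ne χ₁ _ _ (by decide)]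
      exact h1

/-! ## §2 Transfer to `π₁(H₀) = S₃ ⧸ N₀` -/

/-- `ℤ ≅ F₁`, `n ↦ x₀ⁿ`. -/
def zpowEquivF1 : Multiplicative ℤ ≃* FreeGroup (Fin 1) :=
  MonoidHom.toMulEquiv (zpowersHom _ (FreeGroup.of 0)) (FreeGroup.lift fun _ => ofAdd (1 : ℤ))
    (MonoidHom.ext_mint (by simp)) (FreeGroup.ext_hom _ _ fun i => by fin_cases i; simp)

/-- `f = ε₀ ∘ (mod N₀) : S₃ ↠ F₃` (`a₀, a₁, b₂ ↦ 1`; `b₀, b₁, a₂ ↦ x₀, x₁, x₂`). -/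
def f0 : SurfaceGroup 3 →* F₃ := (epsH 0).toMonoidHom.comp (QuotientGroup.mk' (N 0 0))

/-- `f` unfolded. [folklore] -/
theorem f0_apply (s : SurfaceGroup 3) : f0 s = epsH 0 (QuotientGroup.mk s) := rfl

/-- `f` is onto. [folklore] -/
theorem f0_surjective : Function.Surjective f0 :=
  (epsH 0).surjective.comp (QuotientGroup.mk'_surjective _)

/-- `f` kills `a₀, a₁, b₂`. [folklore] -/
theorem f0_of_mem {y : surfaceGen 3} (hy : y ∈ s4Gens 0) : f0 (PresentedGroup.of y) = 1 :=
  epsH_mk_of_mem 0 hy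

/-- `f (b₀, b₁, a₂) = (x₀, x₁, x₂)`. [folklore] -/
theorem f0_of_surv (k : Fin 3) : f0 (PresentedGroup.of (surv 0 k)) = FreeGroup.of k := by
  rw [f0_apply, epsH_mk_of_not_mem 0 (surv_not_mem 0 k), survIdx_surv]

/-- `⟪1, s⟫ = ⟪s⟫`. [folklore] -/
theorem normalClosure_insert_one {G : Type*} [Group G] (s : Set G) :
    Subgroup.normalClosure (insert 1 s) = Subgroup.normalClosure s :=
  le_antisymm
    (Subgroup.normalClosure_le_normal (Set.insert_subset (one_mem _) Subgroup.subset_normalClosure))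
    (Subgroup.normalClosure_mono (Set.subset_insert _ _))

/-- `f(N₁) = Ū` (`N₁ = ⟪a₀, b₁, a₂⟫ ↦ ⟪1, x₁, x₂⟫`). [folklore] -/
theorem map_f0_N1 : (N 0 1).map f0 = U12 := by
  rw [show N 0 1 = Subgroup.normalClosure {SurfaceGroup.a 0, SurfaceGroup.b 1, SurfaceGroup.a 2}
    from rfl, Subgroup.map_normalClosure _ _ f0_surjective]
  simp only [Set.image_insert_eq, Set.image_singleton, show f0 (SurfaceGroup.a 0) = 1 from
    f0_of_mem (by decide), show f0 (SurfaceGroup.b 1) = FreeGroup.of 1 from f0_of_surv 1,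
    show f0 (SurfaceGroup.a 2) = FreeGroup.of 2 from f0_of_surv 2]
  exact normalClosure_insert_one _

/-- `f(N₂) = V̄_N` (`N₂ = ⟪b₀, a₁, a₂⟫ ↦ ⟪x₀, 1, x₂⟫`). [folklore] -/
theorem map_f0_N2 : (N 0 2).map f0 = V02 := by
  rw [show N 0 2 = Subgroup.normalClosure {SurfaceGroup.b 0, SurfaceGroup.a 1, SurfaceGroup.a 2}
    from rfl, Subgroup.map_normalClosure _ _ f0_surjective]
  simp only [Set.image_insert_eq, Set.image_singleton, show f0 (SurfaceGroup.b 0) = FreeGroup.of 0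
    from f0_of_surv 0, show f0 (SurfaceGroup.a 1) = 1 from f0_of_mem (by decide),
    show f0 (SurfaceGroup.a 2) = FreeGroup.of 2 from f0_of_surv 2]
  rw [Set.insert_comm]
  exact normalClosure_insert_one _

/-- Transport along `ε₀`: if `θ(f(L)) = f(L')` then `(ε₀⁻¹ θ ε₀)(L mod N₀) = L' mod N₀`. [folklore] -/
theorem map_conj (θ : F₃ ≃* F₃) {L L' : Subgroup (SurfaceGroup 3)}
    (h : (L.map f0).map θ.toMonoidHom = L'.map f0) :
    (L.map (QuotientGroup.mk' (N 0 0))).map ((epsH 0).trans (θ.trans (epsH 0).symm)).toMonoidHom =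
      L'.map (QuotientGroup.mk' (N 0 0)) := by
  have h' : L'.map (QuotientGroup.mk' (N 0 0)) = (L'.map f0).map (epsH 0).symm.toMonoidHom := by
    rw [Subgroup.map_map]
    congr 1
    ext s
    simp [f0_apply]
  rw [h', ← h]
  simp only [Subgroup.map_map]
  congr 1

/-- **The Nielsen level at genus 3 is vacuous** (stub `stub_genusThreeNielsen` of the line
`free-shadow-tsystem`): for a `(3;1)` group trisection `K = (N₀, N₁, K₂)` of the trivial group some
automorphism `θ` of `π₁(H₀) = S₃ ⧸ N₀` has `θ(N₁ mod N₀) = N₁ mod N₀` and `θ(N₂ mod N₀) = K₂ mod N₀`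
(proof in the module docstring; the pairs hypothesis is unused). [folklore] -/
theorem stub_genusThreeNielsen :
    ∀ (K : TrisectionKernels (3 + 3 * 0)),
      IsGroupTrisection (3 + 3 * 0) (0 + 1) (PUnit : Type) K →
      K 0 = s4Kernels.stabilizeIter 0 0 →
      K 1 = s4Kernels.stabilizeIter 0 1 →
      (∀ i j : Fin 3, i ≠ j → ∃ α : SurfaceGroup (3 + 3 * 0) ≃* SurfaceGroup (3 + 3 * 0),
        (s4Kernels.stabilizeIter 0 i).map α.toMonoidHom = K i ∧
          (s4Kernels.stabilizeIter 0 j).map α.toMonoidHom = K j) →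
      ∃ θ : (SurfaceGroup (3 + 3 * 0) ⧸ s4Kernels.stabilizeIter 0 0) ≃*
          (SurfaceGroup (3 + 3 * 0) ⧸ s4Kernels.stabilizeIter 0 0),
        ((s4Kernels.stabilizeIter 0 1).map (QuotientGroup.mk' (s4Kernels.stabilizeIter 0 0))).map
            θ.toMonoidHom =
          (s4Kernels.stabilizeIter 0 1).map (QuotientGroup.mk' (s4Kernels.stabilizeIter 0 0)) ∧
        ((s4Kernels.stabilizeIter 0 2).map (QuotientGroup.mk' (s4Kernels.stabilizeIter 0 0))).map
            θ.toMonoidHom =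
          (K 2).map (QuotientGroup.mk' (s4Kernels.stabilizeIter 0 0)) := by
  intro K hK h0 h1 _hW
  haveI hKn : ∀ i, (K i).Normal := hK.normal
  -- (A) the character `χ_S : S₃ ↠ ℤ` with kernel `⟪K₀ ∪ K₂⟫` (`free_pairQuotient 0 2`)
  obtain ⟨eP⟩ := hK.free_pairQuotient 0 2 (by decide)
  let χS : SurfaceGroup 3 →* Multiplicative ℤ :=
    zpowEquivF1.symm.toMonoidHom.comp (eP.symm.toMonoidHom.comp (QuotientGroup.mk' _))
  have hχS : ∀ s, χS s = 1 ↔ s ∈ Subgroup.normalClosure ((K 0 : Set (SurfaceGroup 3)) ∪ K 2) :=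
    fun s => by simp only [χS, MonoidHom.comp_apply, MulEquiv.coe_toMonoidHom, MulEquiv.map_eq_one_iff,
      QuotientGroup.mk'_apply, QuotientGroup.eq_one_iff]
  have hχS_surj : Function.Surjective χS :=
    zpowEquivF1.symm.surjective.comp (eP.symm.surjective.comp (QuotientGroup.mk'_surjective _))
  have hK0 : ∀ s ∈ K 0, χS s = 1 := fun s hs => (hχS s).2 (Subgroup.subset_normalClosure (Or.inl hs))
  have hK2 : ∀ s ∈ K 2, χS s = 1 := fun s hs => (hχS s).2 (Subgroup.subset_normalClosure (Or.inr hs))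
  -- (B) descend to `F₃ = S₃ ⧸ N₀` along `f`
  have hN0 : N 0 0 ≤ χS.ker := fun s hs => hK0 s (by rw [h0]; exact hs)
  let χ : F₃ →* Multiplicative ℤ := (QuotientGroup.lift (N 0 0) χS hN0).comp (epsH 0).symm.toMonoidHom
  have hχf : ∀ s, χ (f0 s) = χS s := fun s => by
    simp only [χ, MonoidHom.comp_apply, MulEquiv.coe_toMonoidHom, f0_apply, MulEquiv.symm_apply_apply,
      QuotientGroup.lift_mk]
  -- (C) `ker χ = f(K₂)`
  have hker : χ.ker = (K 2).map f0 := by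
    haveI : ((K 2).map f0).Normal := (hKn 2).map f0 f0_surjective
    refine le_antisymm (fun y hy => ?_) ?_
    · obtain ⟨s, rfl⟩ := f0_surjective y
      rw [MonoidHom.mem_ker, hχf, hχS] at hy
      refine Subgroup.normalClosure_le_normal (N := ((K 2).map f0).comap f0) (Set.union_subset
        (fun k hk => ?_) (Subgroup.le_comap_map f0 (K 2))) hy
      have hk1 : f0 k = 1 := by
        rw [f0_apply, MulEquiv.map_eq_one_iff, QuotientGroup.eq_one_iff]; rw [h0] at hk; exact hk
      exact Subgroup.mem_comap.2 (by rw [hk1]; exact one_mem _)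
    · rintro _ ⟨k, hk, rfl⟩
      rw [MonoidHom.mem_ker, hχf]
      exact hK2 k hk
  -- (D) `(χ x₁, χ x₂)` coprime, from `triple`
  have hcop : IsCoprime (val χ 1) (val χ 2) := by
    obtain ⟨eT⟩ := hK.triple
    let C : Subgroup (Multiplicative ℤ) := Subgroup.closure {χ (FreeGroup.of 1), χ (FreeGroup.of 2)}
    have hUC : U12 ≤ C.comap χ := Subgroup.normalClosure_le_normal (Set.insert_subset_iff.2
      ⟨Subgroup.subset_closure (by simp), Set.singleton_subset_iff.2 (Subgroup.subset_closure (by simp))⟩)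
    have hC : Subgroup.normalClosure (⋃ i, (K i : Set (SurfaceGroup 3))) ≤ (C.comap χ).comap f0 := by
      refine Subgroup.normalClosure_le_normal (Set.iUnion_subset fun i k hk => ?_)
      show χ (f0 k) ∈ C
      fin_cases i
      · rw [hχf, hK0 k hk]; exact one_mem _
      · have hk' : k ∈ K 1 := hk
        rw [h1] at hk'
        have hk'' : f0 k ∈ (N 0 1).map f0 := Subgroup.mem_map_of_mem f0 hk'
        rw [map_f0_N1] at hk''
        exact hUC hk''
      · rw [hχf, hK2 k hk]; exact one_mem _
    have h1C : ofAdd (1 : ℤ) ∈ C := by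
      obtain ⟨s, hs⟩ := hχS_surj (ofAdd 1)
      rw [← hs, ← hχf]
      exact hC ((QuotientGroup.eq_one_iff s).1 (eT.injective (Subsingleton.elim _ _)))
    obtain ⟨m, n, hmn⟩ := Subgroup.mem_closure_pair.1 h1C
    refine ⟨m, n, ?_⟩
    have := congrArg toAdd hmn
    rwa [toAdd_mul, toAdd_zpow, toAdd_zpow, toAdd_ofAdd, smul_eq_mul, smul_eq_mul] at this
  -- (E) the Nielsen moves of §1, transported back along `ε₀`
  obtain ⟨θ', hU, hV⟩ := exists_aut_of_isCoprime χ hcop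
  have hV' : V02.map θ'.toMonoidHom = (K 2).map f0 := by
    rw [← hV, ← MonoidHom.comap_ker, Subgroup.map_comap_eq_self_of_surjective θ'.surjective, hker]
  exact ⟨(epsH 0).trans (θ'.trans (epsH 0).symm), map_conj θ' (by rw [map_f0_N1, hU]),
    map_conj θ' (by rw [map_f0_N2, hV'])⟩

end Summit.SmoothPoincare4.SmoothPoincare4.Theorems.ShadowApproximation.FreeShadowTsystem

end
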